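import Summits.NavierStokesRegularity.FunctionalMining.NoGo.TopBotEigSplitSharpThree
import HarnessLib

/-!
# K22 — `q = 6`: the sharp share `c_axi(6) = (5 − √10)/27` is ATTAINED and the `q = 6` share window is
`Iic (c_axi 6)` (door D-K6 (c); the first exponent beyond K14ʼs `q = 4` on the even ladder)

Search for candidate a priori estimates; no regularity claim.

K19 (`topBotEigSplitting_of_line`) reduces `TopBotEigSplitting q (c_axi q)` to three sign conditions
of one real variable on `[1/3, 2/3]` — (N⁺) `0 < N`, (D) `c(3u−1)s^{q/2−1} ≤ u^{q−1}`, (W) `0 ≤ T` —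
and K20b (`topBotEigSplitting_isGreatest_of_line`, `…_window_of_line`) turns them into the exact window.
K21 discharged them at `q = 3`.  This file discharges them at **`q = 6`**, where every exponent is a
natural number and everything is a POLYNOMIAL in `s = lineNsq u = 6u² − 6u + 2 ∈ [1/2, 2/3]` and `c`:

* §1 closed forms (every real `c`, every real `u`): `u⁶ + (1−u)⁶ = (s³ + 21s² + 12s − 8)/108`,
  `N = (s³ + 21s² + 12s − 8)/108 − c·s³`, `N′ = (2u−1)(2/3 + 7s/3 + s²/6 − 18c·s²)`,
  `N″ = −10/3 + 40s/3 + 5s²/3 + c(72s − 180s²)`, and the **wall-factored identity**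
  `lineT_six : T = (2 − 3s)·(A(s) + c·B(s)) + (4/27)·s⁴·(729c² − 270c + 15)` with
  `A(s) = 10/9 − 5s/9 + 5s²/6 + 25s³/36`, `B(s) = −16s + 20s² − 8s³` — the wall polynomial
  `729c² − 270c + 15 = 729(c − c₋)(c − c₊)`, `c∓ = (5 ∓ √10)/27`, splits off EXACTLY (`ring`).
* §2 at `c = c_axi(6)`: `cAxi_six : cAxi 6 = (5 − √10)/27` (K16ʼs closed form by value),
  `cAxi_six_wall : 729·c² − 270·c + 15 = 0`, `cAxi_six_bounds : 0.068 < c < 0.0681`; hence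
  `lineT_six_cAxi : T = (2 − 3s)(A(s) + c·B(s))`, `T(1/3) = T(2/3) = 0`, and
  **(W)** `lineT_six_nonneg` on `(1/3, 2/3)` (`2 − 3s > 0` inside; `B ≤ 0 < A + 0.0681·B ≤ A + cB`),
  **(N⁺)** `lineN_six_pos` and **(D)** `lineD_six` (`c(3u−1)s² ≤ (681/22500)(3u−1) ≤ u⁵`) on `[1/3, 2/3]`.
* §3 **`topBotEigSplitting_six_isGreatest : IsGreatest {c | TopBotEigSplitting 6 c} (cAxi 6)`**,
  **`topBotEigSplitting_six_sharp : TopBotEigSplitting 6 (cAxi 6)`**, `…_explicit : TopBotEigSplitting 6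
  ((5 − √10)/27)`, **`topBotEigSplitting_six_window : {c | TopBotEigSplitting 6 c} = Iic (cAxi 6)`**,
  `topBotEigSplitting_six_iff : TopBotEigSplitting 6 c ↔ c ≤ cAxi 6`, `sSup … = cAxi 6`.

So four exponents now have the exact window `Iic (c_axi q)` in staged kernel form: `q = 2` (1/3, K20b),
`q = 3` ((5√6 − √22)/24, K21), `q = 4` (2/9, K14/K17/K20b), `q = 6` ((5 − √10)/27, here).  Credit: the
value `c_axi(6) = (5 − √10)/27`, the factorisation `T = (2 − 3s)·P̂₆(s)` and the positivity of `P̂₆` on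
`[1/2, 2/3]` were READ first by census-1 (cc.211)/(cc.213) and census-2 (dd.284) (exact arithmetic /
Bernstein certificates outside Lean — readings, not verdicts, nothing cited); the dictionary confirmed
`c_axi(6)` by hand.  This file re-derives everything in the kernel; all algebra [ours, elementary];
Mathlib: `Real.rpow_ofNat`, `Real.rpow_neg`, `Real.rpow_two`, `Real.sq_sqrt`, `Real.sqrt_lt'`,
`Real.lt_sqrt`, `linear_combination`, `nlinarith`.

NOT claimed: (N⁺)/(D)/(W) for any `q ∉ {2, 3, 4, 6}`; nothing on `heatDissipation`,
`TopEigHeatCoercivePos`, `NegBotEigHeatCoercivePos`; the verdict of record L-λ(q) stays OPEN (kernel)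
for every real `q > 1`.

Imports: the no-go seatʼs staged K21 `NoGo.TopBotEigSplitSharpThree` (→ K20b → K20a, K19, K16 part 2;
used: `lineNsq_lt_two_thirds`, `lineNsq_le_two_thirds` and the K20b window lemmas).  Zero sorries, no
new axioms.
FILING (prove seat g27, REQUEST #38): declarations byte-identical to the no-go seat's staged `TopBotEigSplitSharpSix.STAGING.lean` fa3ecf9bbb225593; this line is the only addition.
-/

noncomputable section

open Real Set

namespace Summit.NavierStokesRegularity.FunctionalMining.TopEig

/-! ## 1. The `q = 6` closed forms: polynomials in `s = lineNsq u` and `c` -/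

section forms

/-- `u⁶ + (1−u)⁶ = (s³ + 21s² + 12s − 8)/108`. [bookkeeping] -/
theorem pow6_add_pow6_lineNsq (u : ℝ) :
    u ^ 6 + (1 - u) ^ 6 = (lineNsq u ^ 3 + 21 * lineNsq u ^ 2 + 12 * lineNsq u - 8) / 108 := by
  unfold lineNsq; ring

/-- `1/2 ≤ s` (`s = 6(u − 1/2)² + 1/2`). [bookkeeping] -/
theorem half_le_lineNsq (u : ℝ) : 1 / 2 ≤ lineNsq u := by
  unfold lineNsq; nlinarith [sq_nonneg (u - 1 / 2)]

/-- `N = (s³ + 21s² + 12s − 8)/108 − c·s³` at `q = 6`. [ours, by value] -/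
theorem lineN_six (c u : ℝ) :
    lineN 6 c u = (lineNsq u ^ 3 + 21 * lineNsq u ^ 2 + 12 * lineNsq u - 8) / 108 - c * lineNsq u ^ 3 := by
  unfold lineN; rw [show (6 : ℝ) / 2 = 3 by norm_num]; simp only [Real.rpow_ofNat]
  rw [pow6_add_pow6_lineNsq]

/-- `N′ = (2u−1)(2/3 + 7s/3 + s²/6 − 18c·s²)` at `q = 6`. [ours, by value] -/
theorem lineN1_six (c u : ℝ) :
    lineN1 6 c u =
      (2 * u - 1) * (2 / 3 + 7 / 3 * lineNsq u + 1 / 6 * lineNsq u ^ 2 - 18 * c * lineNsq u ^ 2) := by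
  unfold lineN1
  rw [show (6 : ℝ) - 1 = 5 by norm_num, show (6 : ℝ) / 2 - 1 = 2 by norm_num]
  simp only [Real.rpow_ofNat]
  unfold lineNsq; ring

/-- `N″ = −10/3 + 40s/3 + 5s²/3 + c(72s − 180s²)` at `q = 6` (uses `(12u−6)² = 12(2s−1)`).
[ours, by value] -/
theorem lineN2_six (c u : ℝ) :
    lineN2 6 c u =
      -(10 / 3) + 40 / 3 * lineNsq u + 5 / 3 * lineNsq u ^ 2 + c * (72 * lineNsq u - 180 * lineNsq u ^ 2) := by
  unfold lineN2
  rw [show (6 : ℝ) - 2 = 4 by norm_num, show (6 : ℝ) / 2 - 2 = 1 by norm_num,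
    show (6 : ℝ) / 2 - 1 = 2 by norm_num]
  simp only [Real.rpow_ofNat, Real.rpow_one]
  unfold lineNsq; ring

/-- **The wall-factored closed form of `T` at `q = 6`, every real `c`:**
`T = (2 − 3s)·(A(s) + c·B(s)) + (4/27)·s⁴·(729c² − 270c + 15)` with
`A(s) = 10/9 − 5s/9 + 5s²/6 + 25s³/36`, `B(s) = −16s + 20s² − 8s³`; the wall polynomial
`729c² − 270c + 15` has the roots `(5 ∓ √10)/27`. [ours, by value] -/
theorem lineT_six (c u : ℝ) :
    lineT 6 c u =
      (2 - 3 * lineNsq u) *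
          (10 / 9 - 5 / 9 * lineNsq u + 5 / 6 * lineNsq u ^ 2 + 25 / 36 * lineNsq u ^ 3 +
            c * (-16 * lineNsq u + 20 * lineNsq u ^ 2 - 8 * lineNsq u ^ 3)) +
        4 / 27 * lineNsq u ^ 4 * (729 * c ^ 2 - 270 * c + 15) := by
  unfold lineT; rw [lineN_six, lineN1_six, lineN2_six]
  have h2u : (2 * u - 1) ^ 2 = (2 * lineNsq u - 1) / 3 := by unfold lineNsq; ring
  have e : (6 - 1 : ℝ) * ((2 * u - 1) *
      (2 / 3 + 7 / 3 * lineNsq u + 1 / 6 * lineNsq u ^ 2 - 18 * c * lineNsq u ^ 2)) ^ 2 =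
      5 * ((2 * lineNsq u - 1) / 3) *
        (2 / 3 + 7 / 3 * lineNsq u + 1 / 6 * lineNsq u ^ 2 - 18 * c * lineNsq u ^ 2) ^ 2 := by
    rw [mul_pow, h2u]; ring
  rw [e]; ring

/-- `T` at the walls, every real `c`: `lineT 6 c (2/3) = lineT 6 c (1/3) = (64/2187)(729c² − 270c + 15)`.
[ours, by value] -/
theorem lineT_six_walls (c : ℝ) :
    lineT 6 c (2 / 3) = 64 / 2187 * (729 * c ^ 2 - 270 * c + 15) ∧
      lineT 6 c (1 / 3) = 64 / 2187 * (729 * c ^ 2 - 270 * c + 15) := by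
  rw [lineT_six, lineT_six, lineNsq_two_thirds, lineNsq_one_third]; constructor <;> ring

end forms

/-! ## 2. `c_axi(6) = (5 − √10)/27` and (N⁺)(D)(W) at `c = c_axi(6)` -/

section signs

/-- `c_axi(6) = (5 − √10)/27` (K16ʼs `cAxi` by value: `S₆ = 65/216`, `B₆ = 5/72`, `R₆ = 5/15552`,
discriminant `(2√10/27)²`). [ours, by value] -/
theorem cAxi_six : cAxi 6 = (5 - Real.sqrt 10) / 27 := by
  have hS : axiS 6 = 65 / 216 := by
    rw [axiS, show (-((6 : ℝ) / 2)) = -3 by norm_num, Real.rpow_neg (by norm_num)]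
    simp only [Real.rpow_ofNat]; norm_num
  have hB : axiB 6 = 5 / 72 := by
    rw [axiB, show (1 : ℝ) - 6 / 2 = -2 by norm_num, Real.rpow_neg (by norm_num), Real.rpow_two]
    norm_num
  have hR : axiR 6 = 5 / 15552 := by
    rw [axiR, show (1 : ℝ) - 6 = -5 by norm_num, Real.rpow_neg (by norm_num)]
    simp only [Real.rpow_ofNat]; norm_num
  have hD : (axiS 6 - axiB 6) ^ 2 + 4 * axiR 6 = (2 * Real.sqrt 10 / 27) ^ 2 := by
    rw [hS, hB, hR, div_pow, mul_pow, Real.sq_sqrt (by norm_num)]; norm_num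
  rw [cAxi, hD, Real.sqrt_sq (by positivity), hS, hB]
  ring

/-- **`c_axi(6)` is a root of the wall polynomial**: `729·c² − 270·c + 15 = 0`. [ours, by value] -/
theorem cAxi_six_wall : 729 * cAxi 6 ^ 2 - 270 * cAxi 6 + 15 = 0 := by
  rw [cAxi_six]
  have h10 : Real.sqrt 10 ^ 2 = 10 := Real.sq_sqrt (by norm_num)
  linear_combination h10

/-- Numerical sanity: `0.068 < c_axi(6) < 0.0681` (`c_axi(6) = 0.068063…`). [ours, by value] -/
theorem cAxi_six_bounds : (68 : ℝ) / 1000 < cAxi 6 ∧ cAxi 6 < 681 / 10000 := by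
  rw [cAxi_six]
  have h10a : (31622 : ℝ) / 10000 < Real.sqrt 10 := by rw [Real.lt_sqrt (by norm_num)]; norm_num
  have h10b : Real.sqrt 10 < 31623 / 10000 := by rw [Real.sqrt_lt' (by norm_num)]; norm_num
  constructor <;> linarith

/-- **`T` at `c = c_axi(6)`**: the wall term drops and `T = (2 − 3s)(A(s) + c·B(s))`. [ours] -/
theorem lineT_six_cAxi (u : ℝ) :
    lineT 6 (cAxi 6) u =
      (2 - 3 * lineNsq u) *
        (10 / 9 - 5 / 9 * lineNsq u + 5 / 6 * lineNsq u ^ 2 + 25 / 36 * lineNsq u ^ 3 +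
          cAxi 6 * (-16 * lineNsq u + 20 * lineNsq u ^ 2 - 8 * lineNsq u ^ 3)) := by
  rw [lineT_six]
  linear_combination (4 / 27 * lineNsq u ^ 4) * cAxi_six_wall

/-- `T` vanishes at both endpoints `u = 1/3`, `u = 2/3` (where `s = 2/3`): (W) is tight at the walls.
[ours, by value] -/
theorem lineT_six_endpoints : lineT 6 (cAxi 6) (1 / 3) = 0 ∧ lineT 6 (cAxi 6) (2 / 3) = 0 := by
  rw [lineT_six_cAxi, lineT_six_cAxi, lineNsq_one_third, lineNsq_two_thirds]; norm_num

/-- **(W) at `q = 6`**: `0 ≤ T` on `(1/3, 2/3)` — there `s < 2/3`, and the cubic factor is positive: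
`B(s) = −4s(2s² − 5s + 4) ≤ 0`, so `A + cB ≥ A + 0.0681·B > 0.85` on `s ∈ [1/2, 2/3]`.  In fact `T > 0`
inside. [ours, elementary] -/
theorem lineT_six_nonneg ⦃u : ℝ⦄ (h1 : 1 / 3 < u) (h2 : u < 2 / 3) : 0 ≤ lineT 6 (cAxi 6) u := by
  rw [lineT_six_cAxi]
  have hc := cAxi_six_bounds
  have hs0 := lineNsq_pos u
  have hs12 := half_le_lineNsq u
  have hs23 := lineNsq_lt_two_thirds h1 h2
  have hB : -16 * lineNsq u + 20 * lineNsq u ^ 2 - 8 * lineNsq u ^ 3 ≤ 0 := by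
    nlinarith [sq_nonneg (lineNsq u - 5 / 4), mul_pos hs0 hs0]
  have hcB : 681 / 10000 * (-16 * lineNsq u + 20 * lineNsq u ^ 2 - 8 * lineNsq u ^ 3) ≤
      cAxi 6 * (-16 * lineNsq u + 20 * lineNsq u ^ 2 - 8 * lineNsq u ^ 3) :=
    mul_le_mul_of_nonpos_right hc.2.le hB
  have hsq : 1 / 4 ≤ lineNsq u ^ 2 := by nlinarith
  have hcu : 0 ≤ lineNsq u ^ 3 := by positivity
  have hA : 0 < 10 / 9 - 5 / 9 * lineNsq u + 5 / 6 * lineNsq u ^ 2 + 25 / 36 * lineNsq u ^ 3 +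
      cAxi 6 * (-16 * lineNsq u + 20 * lineNsq u ^ 2 - 8 * lineNsq u ^ 3) := by nlinarith
  have h23 : 0 < 2 - 3 * lineNsq u := by linarith
  positivity

/-- **(N⁺) at `q = 6`**: `N = (s³ + 21s² + 12s − 8)/108 − c·s³ > 0` on `[1/3, 2/3]` (minimum `≈ 0.0227`
at `s = 1/2`). [ours, elementary] -/
theorem lineN_six_pos ⦃u : ℝ⦄ (h1 : 1 / 3 ≤ u) (h2 : u ≤ 2 / 3) : 0 < lineN 6 (cAxi 6) u := by
  rw [lineN_six]
  have hc := cAxi_six_bounds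
  have hs0 := lineNsq_pos u
  have hs12 := half_le_lineNsq u
  have hs23 := lineNsq_le_two_thirds h1 h2
  have hcu : 0 ≤ lineNsq u ^ 3 := by positivity
  have hcs : cAxi 6 * lineNsq u ^ 3 ≤ 681 / 10000 * lineNsq u ^ 3 :=
    mul_le_mul_of_nonneg_right hc.2.le hcu
  have hs3 : lineNsq u ^ 3 ≤ 2 / 3 * lineNsq u ^ 2 := by nlinarith [mul_pos hs0 hs0]
  have hsq : lineNsq u / 2 ≤ lineNsq u ^ 2 := by nlinarith
  nlinarith

/-- **(D) at `q = 6`**: `c(3u−1)·s² ≤ u⁵` on `[1/3, 2/3]` — `c·s² ≤ 0.0681·(4/9)`, and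
`(681/22500)(3u−1) ≤ 1/243 + (5/81)(u−1/3) + (10/27)(u−1/3)² ≤ u⁵`. [ours, elementary] -/
theorem lineD_six ⦃u : ℝ⦄ (h1 : 1 / 3 ≤ u) (h2 : u ≤ 2 / 3) :
    cAxi 6 * (3 * u - 1) * lineNsq u ^ ((6 : ℝ) / 2 - 1) ≤ u ^ ((6 : ℝ) - 1) := by
  rw [show (6 : ℝ) / 2 - 1 = 2 by norm_num, show (6 : ℝ) - 1 = 5 by norm_num]
  simp only [Real.rpow_ofNat]
  have hc := cAxi_six_bounds
  have hs0 := lineNsq_pos u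
  have hs23 := lineNsq_le_two_thirds h1 h2
  have h3u : 0 ≤ 3 * u - 1 := by linarith
  have hs2 : lineNsq u ^ 2 ≤ 4 / 9 := by nlinarith
  have hcs : cAxi 6 * lineNsq u ^ 2 ≤ 681 / 10000 * (4 / 9) :=
    mul_le_mul hc.2.le hs2 (sq_nonneg _) (by norm_num)
  have hstep : cAxi 6 * (3 * u - 1) * lineNsq u ^ 2 ≤ 681 / 22500 * (3 * u - 1) := by
    calc cAxi 6 * (3 * u - 1) * lineNsq u ^ 2 = cAxi 6 * lineNsq u ^ 2 * (3 * u - 1) := by ring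
      _ ≤ 681 / 10000 * (4 / 9) * (3 * u - 1) := mul_le_mul_of_nonneg_right hcs h3u
      _ = 681 / 22500 * (3 * u - 1) := by ring
  have hd : 0 ≤ u - 1 / 3 := by linarith
  have h5 : 1 / 243 + 5 / 81 * (u - 1 / 3) + 10 / 27 * (u - 1 / 3) ^ 2 ≤ u ^ 5 := by
    nlinarith [pow_nonneg hd 3, pow_nonneg hd 4, pow_nonneg hd 5]
  have hq : 681 / 22500 * (3 * u - 1) ≤ 1 / 243 + 5 / 81 * (u - 1 / 3) + 10 / 27 * (u - 1 / 3) ^ 2 := by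
    nlinarith [sq_nonneg (u - 1 / 3 - 1 / 25)]
  exact hstep.trans (hq.trans h5)

end signs

/-! ## 3. `q = 6`: the sharp share is attained and the window is `Iic (c_axi 6)` -/

section window

/-- **`c_axi(6)` is the greatest `q = 6` share** (K20b `topBotEigSplitting_isGreatest_of_line` with
(N⁺)(D)(W) discharged). [ours] -/
theorem topBotEigSplitting_six_isGreatest :
    IsGreatest {c : ℝ | TopBotEigSplitting 6 c} (cAxi 6) :=
  topBotEigSplitting_isGreatest_of_line (by norm_num) lineN_six_pos lineD_six lineT_six_nonneg

/-- **`TopBotEigSplitting 6 (cAxi 6)`** — the sharp `q = 6` share is ATTAINED. [ours] -/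
theorem topBotEigSplitting_six_sharp : TopBotEigSplitting 6 (cAxi 6) :=
  topBotEigSplitting_six_isGreatest.1

/-- The same with the closed form: `TopBotEigSplitting 6 ((5 − √10)/27)`. [ours] -/
theorem topBotEigSplitting_six_sharp_explicit : TopBotEigSplitting 6 ((5 - Real.sqrt 10) / 27) :=
  cAxi_six ▸ topBotEigSplitting_six_sharp

/-- **The `q = 6` share window is exactly `(-∞, c_axi(6)]`**. [ours] -/
theorem topBotEigSplitting_six_window : {c : ℝ | TopBotEigSplitting 6 c} = Iic (cAxi 6) :=
  topBotEigSplitting_window_of_line (by norm_num) lineN_six_pos lineD_six lineT_six_nonneg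

/-- Pointwise form at `q = 6`: `TopBotEigSplitting 6 c ↔ c ≤ c_axi(6)`. [ours] -/
theorem topBotEigSplitting_six_iff (c : ℝ) : TopBotEigSplitting 6 c ↔ c ≤ cAxi 6 :=
  topBotEigSplitting_iff_le_cAxi_of_line (by norm_num) lineN_six_pos lineD_six lineT_six_nonneg c

/-- `sSup {c | TopBotEigSplitting 6 c} = c_axi(6)`. [ours] -/
theorem sSup_topBotEigSplitting_six : sSup {c : ℝ | TopBotEigSplitting 6 c} = cAxi 6 :=
  sSup_topBotEigSplitting_of_line (by norm_num) lineN_six_pos lineD_six lineT_six_nonneg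

/-- The four closed exponents side by side: the exact share windows at `q = 2, 3, 4, 6`. [ours; summary] -/
theorem topBotEigSplitting_windows_two_three_four_six :
    {c : ℝ | TopBotEigSplitting 2 c} = Iic (1 / 3) ∧ {c : ℝ | TopBotEigSplitting 3 c} = Iic (cAxi 3) ∧
      {c : ℝ | TopBotEigSplitting 4 c} = Iic (2 / 9) ∧ {c : ℝ | TopBotEigSplitting 6 c} = Iic (cAxi 6) :=
  ⟨topBotEigSplitting_two_window, topBotEigSplitting_three_window, topBotEigSplitting_four_window,
    topBotEigSplitting_six_window⟩

end window

end Summit.NavierStokesRegularity.FunctionalMining.TopEig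

end
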